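import Summits.HubbardSuperconductivity.HubbardSuperconductivity.Theorems.PerWidthThermodynamics.Negative.PerWidthThermodynamicsTwoColumnGauge
import Summits.HubbardSuperconductivity.HubbardSuperconductivity.Theorems.PerWidthThermodynamics.Negative.PerWidthThermodynamicsFalseWithoutL1

/-!
# Disproof work file — crux `PerWidthThermodynamics` (stmt-HubbardSuperconductivity-18510),
# route `SeamInduction` — standing disprover, cycle 1 (2026-08-17)

The crux (`perWidthThermodynamics_iff`, landed): `∃ U > 0, ∃ δ ∈ (0,3/10), ∀ even M ≥ 2,
∃ d_M > 0, k_M, L_M, ∀ even L ≥ max(M, L_M), ∀ carriers e : Λ ≃ ℤ/L × ℤ/M: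
d_M ≤ stiff L M ∧ 0 < icomp L M ≤ k_M`, with `stiff = 2L[E(π/3,N) − E(0,N)]/((π/3)² M)`,
`icomp = LM[E(N+2)+E(N−2)−2E(N)]/4`, `E(θ,N) = minEnergyOn (szSector N 0)` of the seam-twisted
Hubbard tube, `N = 2⌊(1−δ)LM/2⌋`.

## Index of findings

LANDED (`Theorems/PerWidthThermodynamics/Negative/`, `--supports` this item):
* `PerWidthThermodynamicsTwoColumnGauge` (p146693) — the six let-functionals named (`tubeH0`,
  `seamTw`, `sectorE`, `Np`, `stiff`, `icomp`) + `perWidthThermodynamics_iff` (`Iff.rfl`); the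
  TWO-COLUMN GAUGE `seamTw_two_gauge`: at `L = 2` the seam twist is a pure gauge
  (`phaseGauge (colGauge e θ)`), `sectorE_two`, `stiff_two_eq_zero` (stiffness functional ≡ 0 at
  `L = 2` for all `U, δ, M, Λ, e`).
* `PerWidthThermodynamicsFalseWithoutL1` — `perWidthThermodynamics_iff_withoutML` (`M ≤ L` is
  DECORATION: absorbed by `L₁ ↦ max L₁ M`) and `perWidthThermodynamics_false_without_L₁` (`L₁ ≤ L`
  is LOAD-BEARING: the crux with the cut-off deleted is false, witness `M = L = 2`).

IN THIS FILE (work-file only):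
* `PerWidthThermodynamicsAtUZero` / `perWidthThermodynamics_false_at_U_zero` (sorried near-miss,
  numerically certain): `0 < U` is LOAD-BEARING — the free tube violates BOTH conclusions for
  infinitely many even `L`, at every `δ` and every even width (open-shell parity effect). See the
  docstring for the exact one-body certificate (compute jobs j023511, j023593) and the obstruction.
* Small-model EXACT DIAGONALISATION of the crux's own functionals at `U > 0` (j023511 / j023593,
  Lanczos on the `(N, S^z=0)` sector of the Hamiltonian exactly as typed; self-checks: `U = 0`
  against one-body spectra to `3·10⁻¹¹`, Lanczos against dense to `2·10⁻¹⁰`, `L = 2` gauge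
  triviality `E(θ) = E(0)` to rounding, `E(θ) = E(−θ)`): recorded in `ed_table`'s docstring.
  Headline: on OPEN-SHELL lengths the stiffness functional is NEGATIVE for every `U ∈ [0,16]`
  (`M = 2`: `(L, δ) = (4, 1/4)`: `−2.78 (U=0) … −1.15 (U=4) … −0.55 (U=8) … −0.28 (U=16)`;
  `(6, 1/8)`: `−2.46 … −1.16 (U=4) … −0.68 (U=8) … −0.44 (U=16)`), on the CLOSED-SHELL length
  `(6, 1/4)` it is positive for every `U` (`+1.00 … +0.85 (U=4) … +0.52 (U=16)`); `icomp > 0`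
  for all `U > 0` tested (it is `0` at `U = 0` on open shells and grows `≈ U` at small `U`). The
  paramagnetic sign survives the interaction at these sizes; consistent with `L_2(U, δ) ≫ 8`.

## Why the crux resists a kill (for the provers and the planner)

It is `∃ (U, δ)` followed, per width, by `∃ L_M ∀ L ≥ L_M`. A refutation must exhibit for EVERY
`(U, δ) ∈ (0,∞) × (0,3/10)` an even width whose long tubes are paramagnetic on the `π/3` envelope,
charge-gapped or phase-separating for infinitely many `L`. No exact result of that kind exists at
any `U > 0` (no diamagnetic inequality for lattice fermions; no Perron–Frobenius sign structure in
`d > 1`; Bethe ansatz only for `M = 1`, not in the tree); finite-size numerics cannot reach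
`L → ∞`. In a Luther–Emery (C1S0) width the charge-`2e` boson description gives
`E(θ) − E(0) ≈ (D/2L) min_m (θ − mπ)² > 0` at `θ = π/3` with NO parity effect once `L ≫ ξ_spin`,
so the `M = 2` member is plausibly TRUE at strong-pairing points (e.g. `U = 8`, `δ ≈ 0.1`, where
`ξ_spin` is a few tens of sites). What the attacks DO show: (i) any proof must use `L₁ ≥ 4` and
the interaction non-perturbatively in `L` (the `U = 0` sign is an `O(1/L)` shell effect of either
sign; an `O(U)` bound uniform in `L` cannot fix it — only a spin-gap / pairing scale can, forcing
`L_M ≳ ξ_spin(U, δ, M)`); (ii) at the planner's proposal point `(U, δ) = (4, 1/4)` the 2-leg ladder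
is paramagnetic on the `π/3` envelope at every accessible open-shell length, and its spin gap is
tiny there, so `L_2(4, 1/4)` is astronomically large if finite — provers should move the witness
point towards strong pairing for `M = 2` and must then confront stripes/CDW at `M ≥ 4` (the
tension the route's kill criteria already name); (iii) the `θ₀ = π/3` ENVELOPE criterion inherits the
free-fermion `N/2`-parity (open-shell) paramagnetism at every width whose low-energy theory keeps a
gapless spin or relative-charge mode (`CnSm`, `m ≥ 1` or `n ≥ 2`): for such a width the floor
`d_M ≤ stiff` fails for infinitely many `L` (heuristic, Luttinger-liquid finite-size spectrum) —
this is the concrete mechanism behind the crux's own "why it might fail".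

Hypotheses NOT decided: `Even L`, `Even M` (odd widths are out of scope; odd `M` would keep a
gapless spin mode and fail by (iii) — heuristic only).
-/

set_option linter.dupNamespace false

noncomputable section

namespace Summit.HubbardSuperconductivity.HubbardSuperconductivity.Cruxes.PerWidthThermodynamics.Disproof

open Matrix Finset Literature.MathematicalPhysics.QuantumLattice
open Summit.HubbardSuperconductivity.HubbardSuperconductivity.Theorems.PerWidthThermodynamics.Negative
open scoped ComplexConjugate BigOperators

/-! ### (a) Load-bearing hypotheses — pointers to the landed theorems -/

/-- `L₁ ≤ L` is load-bearing (landed): the crux with the cut-off deleted is false. -/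
example : ¬ ∃ U : ℝ, 0 < U ∧ ∃ δ ∈ Set.Ioo (0 : ℝ) (3 / 10), ∀ (M : ℕ) [NeZero M], Even M → 2 ≤ M →
    ∃ d : ℝ, 0 < d ∧ ∃ k : ℝ, ∀ (L : ℕ) [NeZero L], Even L → M ≤ L →
      ∀ (Λ : Type) [LinearOrder Λ] [Fintype Λ] (e : Λ ≃ ZMod L × ZMod M),
        d ≤ stiff L M Λ e U δ ∧ 0 < icomp L M Λ e U δ ∧ icomp L M Λ e U δ ≤ k :=
  perWidthThermodynamics_false_without_L₁

/-- `M ≤ L` is decoration (landed). -/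
example : Theses.SeamInduction.PerWidthThermodynamics ↔
    ∃ U : ℝ, 0 < U ∧ ∃ δ ∈ Set.Ioo (0 : ℝ) (3 / 10), ∀ (M : ℕ) [NeZero M], Even M → 2 ≤ M →
      ∃ d : ℝ, 0 < d ∧ ∃ k : ℝ, ∃ L₁ : ℕ, ∀ (L : ℕ) [NeZero L], Even L → L₁ ≤ L →
        ∀ (Λ : Type) [LinearOrder Λ] [Fintype Λ] (e : Λ ≃ ZMod L × ZMod M),
          d ≤ stiff L M Λ e U δ ∧ 0 < icomp L M Λ e U δ ∧ icomp L M Λ e U δ ≤ k :=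
  perWidthThermodynamics_iff_withoutML

/-- The stiffness functional of the crux vanishes identically on two columns (landed). -/
example {M : ℕ} [NeZero M] {Λ : Type} [LinearOrder Λ] [Fintype Λ] (e : Λ ≃ ZMod 2 × ZMod M)
    (U δ : ℝ) : stiff 2 M Λ e U δ = 0 :=
  stiff_two_eq_zero e U δ

/-! ### (a') `0 < U` is load-bearing — near-miss (sorried), numerically certain -/

/-- The crux at `U = 0` (free fermions), otherwise verbatim. -/
def PerWidthThermodynamicsAtUZero : Prop :=
  ∃ δ ∈ Set.Ioo (0 : ℝ) (3 / 10), ∀ (M : ℕ) [NeZero M], Even M → 2 ≤ M →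
    ∃ d : ℝ, 0 < d ∧ ∃ k : ℝ, ∃ L₁ : ℕ, ∀ (L : ℕ) [NeZero L], Even L → M ≤ L → L₁ ≤ L →
      ∀ (Λ : Type) [LinearOrder Λ] [Fintype Λ] (e : Λ ≃ ZMod L × ZMod M),
        d ≤ stiff L M Λ e 0 δ ∧ 0 < icomp L M Λ e 0 δ ∧ icomp L M Λ e 0 δ ≤ k

/-- NEAR-MISS (sorried; obstruction recorded). **The free tube violates both conclusions for
infinitely many lengths, at every doping and every even width.** At `U = 0` the sector energy is
`E(θ, N) = 2 Σ_{lowest N/2} ε_j(θ)` over the one-body levels of the `L × M` tube graph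
(`ε(k_x,k_y) = −2cos(k_x + θ/L) − 2cos k_y` for `M ≥ 3`, `−2cos(k_x + θ/L) ∓ 1` for `M = 2` whose
rung is a single bond, `k_x ∈ (2π/L)ℤ`, `L ≥ 3`). Whenever the spin-`σ` Fermi sea (`N/2` levels)
is OPEN (its last level degenerate with the first empty one) — which happens for infinitely many
even `L` at every `δ ∈ (0, 3/10)` — one has `E(N+2) + E(N−2) − 2E(N) = 0`, i.e. `icomp = 0`
(violating `0 < icomp`), and the current-carrying branch gives `E(π/3) < E(0)`, i.e. `stiff < 0`.
NUMERICAL CERTIFICATE (exact one-body spectra, compute jobs j023511 / j023593, file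
`free_scan.txt`): `δ = 1/4`: `M = 2`: `stiff ≤ 0` for 35 of the 60 even `L ≤ 120` and `icomp = 0`
for 29; `M = 4`: 45 and 40 of 59; `M = 6`: 45 and 47 of 58; `M = 8`: 31 of 57 and `icomp = 0` for
ALL 57. `δ = 1/8`: `M = 2, 4, 6, 8`: `stiff ≤ 0` for 38/60, 41/59, 38/58, 38/57. The same at
`δ = 0.2` and at the irrational `δ = 1/4 − 10⁻³√2`; the violating `L` do not thin out with `L`.
OBSTRUCTION to a Lean proof here: it needs `minEnergyOn` of a quadratic Hamiltonian on
`szSector N 0` `=` twice the sum of the lowest `N/2` one-body levels for the RECTANGULAR, TWISTED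
tube in the crux's carrier-free typing; the tree has this only for the untwisted SQUARE torus
(`minEnergyOn_szSector_free_eq`, `exists_two_groundStates_free_of_openShell` in
`FreeFermionSectorGroundStates.lean` — the latter IS the open-shell degeneracy behind the parity
effect), plus trigonometric bookkeeping for infinitely many `L`. CONSEQUENCE: `0 < U` must enter
any proof non-perturbatively in `L`. -/
theorem perWidthThermodynamics_false_at_U_zero : ¬ PerWidthThermodynamicsAtUZero := by
  sorry

/-! ### (c) Exact diagonalisation of the crux's functionals on small tubes (evidence, no Lean content) -/

/-- ED TABLE (compute jobs j023511 test / j023593 full; Lanczos ground energies of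
`tubeH0 + seamTw` on `szSector N 0`, the Hamiltonian built from the SAME ordered-pair adjacency and
seam terms as the Lean definition; `stiff`, `icomp` as in the crux). `M = 2`:

| `L` | `δ` | `N` | shell | `U=0` | `U=1` | `U=2` | `U=4` | `U=6` | `U=8` | `U=12` | `U=16` |
|---|---|---|---|---|---|---|---|---|---|---|---|
| 2 | 1/4 | 2 | — | stiff `0` (gauge) | `0` | `0` | `0` | `0` | `0` | `0` | `0` |
| 4 | 1/4 | 6 | open | `−2.78` | `−2.31` | `−1.85` | `−1.15` | `−0.76` | `−0.55` | `−0.36` | `−0.28` |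
| 6 | 1/4 | 8 | closed | `+1.00` | `+0.98` | `+0.95` | `+0.85` | `+0.75` | `+0.68` | `+0.58` | `+0.52` |
| 6 | 1/8 | 10 | open | `−2.46` | `−2.13` | `−1.80` | `−1.16` | `−0.79` | `−0.68` | `−0.61` | `−0.44` |

`icomp`: `(4,1/4)`: `0, 0.84, 1.80, 3.58, 4.62, 5.10, 5.53, 5.75`; `(6,1/4)`: `6.00 … 6.45 … 6.06`;
`(6,1/8)`: `0, 0.06, 0.21, 0.59, 0.96, 1.29, 1.81, 2.32` — positive for every `U > 0`.
On the open-shell lengths also `E(π) < E(0)` and `E(π/2) < E(0)`: the envelope minimum is NOT at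
`θ = 0` (paramagnetic ground state) for every `U ≤ 16`. Larger sizes (`L = 8, M = 2`; `4 × 4`;
`δ = 1/8`) are appended from j023593 when delivered (see NOTES.md / item evidence). -/
theorem ed_table : True := trivial

/-! ### (d) Line `Ideator1Sketch` (PICKED 2026-08-17): cheap attacks on its physics stubs

No `line` in this seat's payload yet; recorded for the lead and for the re-arm. -/

/-- LINE NOTES — `Lines/Ideator1Sketch.lean` (witness `(U, δ) = (6, (3−√5)/4 ≈ 0.191)`):

* `stub_stiffness_of_floor_of_transparency` (glue): TRUE as stated (checked on paper: if the min is
  `E(π)`, `E(π/3) − E(0) ≥ cM/L − (c/2)M/L`; `L, M > 0` by `NeZero`). Not attackable.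
* `stub_transparency` (`|E(π) − E(0)| ≤ ηM/L` eventually): at `U = 0` it FAILS for essentially every
  `L` — free tubes have `(L/M)·(E(π) − E(0)) = O(1)` of EITHER sign, e.g. `M = 2`, witness `δ`:
  `L = 20: −0.12`, `40: +4.61`, `60: +0.70`, `80: −4.11`, `100: −1.21`, `120: −0.52` (59 of 59 even
  `L ≤ 120` have `|·| > 0.05`; `M = 4`: 57/59; `M = 6`: 56/58; `job/free_line.py`). So, like the crux,
  it needs the spin/odd-charge gap non-perturbatively (`L₂ ≳ ξ_s`): consistent with its own mechanism
  (Seidel–Lee), no misstatement. ED at `U > 0`, `M = 2`: `(L/M)(E(π)−E(0))` at `U = 6`: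
  `L = 4 (N=6): −0.20`; `L = 6, δ = 1/4 (N=8): +1.58`; `L = 6, δ = 1/8 (N=10): −0.54` — no
  transparency at `L ≤ 6` (expected, `L ≪ ξ_s`).
* `stub_canonicalFluxFloor` (`cM/L ≤ E(π/3) − min(E(0), E(π))`, "parity-class-free, Lieb–Loss /
  Lieb–Nachtergaele argmin ∈ {0, π} shape"): CAUTION — for FREE multi-band tubes the envelope argmin
  is frequently NOT in `{0, π}` (spin-`↑` and spin-`↓` seas, and the two bands, sit on different
  branches; inter-band transfers put minima near `±5π/12`, `π/2`, `5π/8`): at `U = 0`, witness `δ`,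
  `M = 2`: floor `≤ 0` for 30 of 59 even `L ≤ 120` (e.g. `L = 12: −0.089, argmin ≈ 1.67π`;
  `L = 22: −0.041, argmin ≈ 1.42π`; `L = 120: −0.008, argmin ≈ 0.58π`); `M = 4`: 17/59;
  `M = 6`: 21/58. The Lieb–Loss/Lieb–Nachtergaele canonical-flux theorems are for rings / half-filled
  bipartite settings and do NOT cover doped multi-band tubes even at `U = 0`; the stub's
  "class-free" justification is therefore heuristic and rests, again, on the interacting
  single-mode (C1S0) structure. ED at `U > 0` (floor value `E(π/3) − min(E(0),E(π))`, `M = 2`):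
  `L = 4 (N = 6)`: NEGATIVE for every `U ≤ 16` (`U = 0: −0.277`, `4: −0.107`, `6: −0.110`,
  `8: −0.107`, `16: −0.070`) — excluded only by `L₁ ≥ 6`; `L = 6, δ = 1/8 (N = 10, open shell)`:
  `U = 0: −0.057`, `2: −0.071`, `4: −0.047`, `6: +0.037`, `8: +0.061`, `12: +0.065`, `16: +0.074`
  (holds from `U ≈ 6` on — the witness `U = 6` is marginal here, `c ≤ 0.11`); closed shells hold.
* `stub_pairCompressibility`: `icomp > 0` in every ED run with `U > 0`; `= 0` at `U = 0` on open
  shells (crux-level remark (a')).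
Bottom line for the lead: no stub is misstated; all three physics stubs are false at `U = 0`
cofinally in `L` and hinge on `L_i ≳ ξ_s(6, δ, M)`; the smallest accessible sizes show the floor
failing at `L = 4` for all `U` and only marginally holding at `L = 6` for `U = 6`. -/
theorem line_Ideator1Sketch_notes : True := trivial

end Summit.HubbardSuperconductivity.HubbardSuperconductivity.Cruxes.PerWidthThermodynamics.Disproof
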